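import Literature.NumberTheory.GaloisRepresentations.SUnitsGaloisModule
import Literature.NumberTheory.Automorphic.IdeleIdealClass
import Mathlib.NumberTheory.RamificationInertia.Valuation
import Mathlib.NumberTheory.NumberField.ClassNumber
import HarnessLib

/-!
# `S`-units by valuations: `x ∈ 𝒪_{E,S}ˣ ⟺ w(x) = 0` at every finite place `w ∤ S` (the integral
# closure of `𝒪_{K,S}` in `E` is `𝒪_{E,S_E}`)

Topic `NumberTheory/GaloisRepresentations`; namespace
`Literature.NumberTheory.GaloisRepresentations.SUnits`.  THEOREMS ONLY (no definition, no named fact,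
no `sorry`, no instance; D-0026).  Sequel of `SUnitsGaloisModule.lean` (`sUnits K S L`: units of `L`
that are, with their inverses, integral over the `S`-integers `𝒪_{K,S} = S.integer K`).

For a finite extension `E/K` of number fields (as usual `S` a set of finite places of `K`, and for a
finite place `w` of `E`, `w.under (𝓞 K)` the place of `K` below it) the definition by integrality
agrees with the textbook one by valuations: **`mem_sUnits_iff_forall_valuation_eq_one`**:
`x ∈ sUnits K S E ↔ ∀ w, w.under (𝓞 K) ∉ S → w.valuation E x = 1` ("`𝒪_{K,S}^×` the `S`-units,
i.e. `v(x) = 0` for `v ∉ S`", Neukirch–Schmidt–Wingberg VIII §3; Neukirch VI §1: the integral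
closure of `𝒪_{K,S}` in `E` is the ring of `S_E`-integers, `S_E` = the places above `S`).

* `⟹` (`valuation_le_one_of_isIntegral_of_forall`, `valuation_eq_one_of_mem_sUnits`): an element
  integral over a ring all of whose elements have `w`-valuation `≤ 1` has `w`-valuation `≤ 1`
  (ultrametric inequality on the integral equation; the coefficients `c ∈ 𝒪_{K,S}` have
  `w(c) = u(c)^{e(w|u)} ≤ 1` for `u = w.under ∉ S`, Mathlib `valuation_liesOver`); with `x⁻¹` too,
  `w(x) = 1`.
* `⟸` (`isIntegral_sInteger_of_forall_valuation_le_one`): if `w(x) ≤ 1` for all `w ∤ S`, the finitely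
  many places `w` with `w(x) > 1` lie over a finite set `U ⊆ S` of places of `K`; with `h` the class
  number of `K`, `(∏_{u ∈ U} 𝔭_u)^h = (a)` is principal, `a ∈ 𝓞_K` is an `S`-unit of `K`
  (`a⁻¹ ∈ 𝒪_{K,S}`), and `aᴺ·x` has ALL valuations `≤ 1` for `N ≫ 0`, so lies in `𝓞_E`
  (Mathlib `mem_integers_of_valuation_le_one`) and is integral over `ℤ ⊆ 𝒪_{K,S}`; hence
  `x = a⁻ᴺ · (aᴺ x)` is integral over `𝒪_{K,S}`.

Lane «PT3-TC» of cell `bsd-eis` (crux `GoodLatticeBDPValue`, stmt-BirchSwinnertonDyer-19032; road memo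
`PT3TC-ROAD.md`, brick (A1b)): this is the bridge between the tree's Galois-module `sUnits` /
`sUnitsRep` (A1) and the idelic `S`-units "principal idèles in `J_{E,S}`" of the finite-layer bricks.

## References
* J. Neukirch, A. Schmidt, K. Wingberg, *Cohomology of Number Fields*, 2nd ed. (2008), VIII §3
  (notation `𝒪_{K,S}`, `E_{K,S}`). [NeukirchSchmidtWingberg2008]
* J. Neukirch, *Algebraic Number Theory* (1999), Ch. I (11.1)/(11.6) (`S`-integers and `S`-units as
  an intersection of valuation rings; finiteness of the class number), Ch. VI §1. [NeukirchANT1999]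
-/

noncomputable section

open NumberField IsDedekindDomain Field
open Literature.NumberTheory.Automorphic (FractionalIdeal.count_spanSingleton_eq_neg_log_valuation)
open scoped nonZeroDivisors

namespace Literature.NumberTheory.GaloisRepresentations.SUnits

/-! ### §1. Integral elements have valuation `≤ 1` -/

/-- **Ultrametric integrality bound**: for a valuation `v` on a field `E` and a ring `R → E` all of
whose elements have `v`-valuation `≤ 1`, every `R`-integral `x ∈ E` has `v(x) ≤ 1` (if `v(x) > 1`
the leading term `xⁿ` of a monic integral equation strictly dominates the others).  Mathlib's
`Valuation.Integers.isIntegral_iff_v_le_one` is the case `R =` the valuation ring.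
[cite: NeukirchANT1999, Ch. II (6.2) / Ch. I (11.6) (valuation rings are integrally closed)] -/
theorem valuation_le_one_of_isIntegral_of_forall {R E Γ₀ : Type*} [CommRing R] [Field E]
    [Algebra R E] [LinearOrderedCommGroupWithZero Γ₀] (v : Valuation E Γ₀)
    (hR : ∀ r : R, v (algebraMap R E r) ≤ 1) {x : E} (hx : IsIntegral R x) : v x ≤ 1 := by
  classical
  obtain ⟨f, hm, hf⟩ := hx
  by_contra hlt
  rw [not_le] at hlt
  by_cases hn : f.natDegree = 0
  · rw [Polynomial.Monic.natDegree_eq_zero hm] at hn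
    rw [hn, Polynomial.eval₂_one] at hf
    exact one_ne_zero hf
  simp only [Polynomial.eval₂_eq_sum_range, Finset.sum_range_succ, hm.coeff_natDegree, map_one,
    one_mul, add_eq_zero_iff_eq_neg] at hf
  apply_fun v at hf
  simp only [Valuation.map_neg, map_pow] at hf
  refine (ne_of_lt (v.map_sum_lt ?_ ?_)) hf
  · exact pow_ne_zero _ (zero_lt_one.trans hlt).ne'
  · intro i hi
    simp only [Finset.mem_range] at hi
    rw [map_mul, map_pow]
    exact mul_lt_of_le_one_of_lt (hR _) (pow_lt_pow_right₀ hlt hi)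

variable {K : Type} [Field K] [NumberField K] {S : Set (HeightOneSpectrum (𝓞 K))}
variable {E : Type} [Field E] [NumberField E] [Algebra K E]

/-- The valuation at `w` of an element of `K` is the `e(w|u)`-th power of its valuation at the place
`u = w.under` below `w` (Mathlib `valuation_liesOver`); in particular `w(c) ≤ 1 ⟺ u(c) ≤ 1`.
[cite: NeukirchANT1999, Ch. II (8.1)–(8.2) (extension of valuations, ramification index)] -/
theorem valuation_algebraMap_le_one_iff (w : HeightOneSpectrum (𝓞 E)) (c : K) :
    w.valuation E (algebraMap K E c) ≤ 1 ↔ (w.under (𝓞 K)).valuation K c ≤ 1 := by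
  haveI : w.asIdeal.LiesOver (w.under (𝓞 K)).asIdeal := ⟨rfl⟩
  have he : (w.under (𝓞 K)).asIdeal.ramificationIdx' w.asIdeal ≠ 0 :=
    Ideal.IsDedekindDomain.ramificationIdx'_ne_zero_of_liesOver w.asIdeal (w.under (𝓞 K)).ne_bot
  rw [← HeightOneSpectrum.valuation_liesOver E (w.under (𝓞 K)) w c]
  exact pow_le_one_iff he

/-- Same with `= 1`: `w(c) = 1 ⟺ u(c) = 1` for `c ∈ K`, `u = w.under`.
[cite: NeukirchANT1999, Ch. II (8.1)–(8.2)] -/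
theorem valuation_algebraMap_eq_one_iff (w : HeightOneSpectrum (𝓞 E)) (c : K) :
    w.valuation E (algebraMap K E c) = 1 ↔ (w.under (𝓞 K)).valuation K c = 1 := by
  haveI : w.asIdeal.LiesOver (w.under (𝓞 K)).asIdeal := ⟨rfl⟩
  have he : (w.under (𝓞 K)).asIdeal.ramificationIdx' w.asIdeal ≠ 0 :=
    Ideal.IsDedekindDomain.ramificationIdx'_ne_zero_of_liesOver w.asIdeal (w.under (𝓞 K)).ne_bot
  rw [← HeightOneSpectrum.valuation_liesOver E (w.under (𝓞 K)) w c]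
  constructor
  · intro h
    exact le_antisymm ((pow_le_one_iff he).1 h.le) ((one_le_pow_iff he).1 h.ge)
  · intro h
    rw [h, one_pow]

/-- Elements of `𝒪_{K,S}` have `w`-valuation `≤ 1` at every place `w` of `E` not above `S`.
[cite: NeukirchSchmidtWingberg2008, VIII §3] -/
theorem valuation_algebraMap_sInteger_le_one (w : HeightOneSpectrum (𝓞 E)) (hw : w.under (𝓞 K) ∉ S)
    (c : S.integer K) : w.valuation E (algebraMap (S.integer K) E c) ≤ 1 := by
  rw [IsScalarTower.algebraMap_apply (S.integer K) K E]
  exact (valuation_algebraMap_le_one_iff w _).2 (Set.integer_valuation_le_one S K c hw)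

/-- **`⟹`, half**: an element of `E` integral over `𝒪_{K,S}` has valuation `≤ 1` at every place not
above `S`. [cite: NeukirchSchmidtWingberg2008, VIII §3] [cite: NeukirchANT1999, Ch. I (11.6)] -/
theorem valuation_le_one_of_isIntegral_sInteger {x : E} (hx : IsIntegral (S.integer K) x)
    (w : HeightOneSpectrum (𝓞 E)) (hw : w.under (𝓞 K) ∉ S) : w.valuation E x ≤ 1 :=
  valuation_le_one_of_isIntegral_of_forall (w.valuation E) (valuation_algebraMap_sInteger_le_one w hw) hx

/-- **`⟹`**: an `S`-unit of `E` over `K` (`sUnits K S E`) has `w`-valuation `1` at every finite place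
`w` of `E` not above `S`. [cite: NeukirchSchmidtWingberg2008, VIII §3 ("`v(x) = 0` for `v ∉ S`")] -/
theorem valuation_eq_one_of_mem_sUnits {x : Eˣ} (hx : x ∈ sUnits K S E)
    (w : HeightOneSpectrum (𝓞 E)) (hw : w.under (𝓞 K) ∉ S) : w.valuation E (x : E) = 1 := by
  have h1 := valuation_le_one_of_isIntegral_sInteger hx.1 w hw
  have h2 := valuation_le_one_of_isIntegral_sInteger hx.2 w hw
  refine le_antisymm h1 ?_
  have hmul : w.valuation E (x : E) * w.valuation E (↑x⁻¹ : E) = 1 := by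
    rw [← map_mul, Units.mul_inv, map_one]
  calc (1 : WithZero (Multiplicative ℤ)) = w.valuation E (x : E) * w.valuation E (↑x⁻¹ : E) := hmul.symm
    _ ≤ w.valuation E (x : E) * 1 := mul_le_mul' le_rfl h2
    _ = w.valuation E (x : E) := mul_one _

/-! ### §2. The converse: valuations `≤ 1` off `S` give integrality over `𝒪_{K,S}` -/

/-- The places of `E` at which `x ≠ 0` has valuation `≠ 1` form a finite set (finitely many prime
factors of the fractional ideal `(x)`). [cite: NeukirchANT1999, Ch. I (3.9) / (11.1)] -/
theorem finite_setOf_valuation_ne_one {x : E} (hx : x ≠ 0) :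
    {w : HeightOneSpectrum (𝓞 E) | w.valuation E x ≠ 1}.Finite := by
  have h := FractionalIdeal.finite_factors (FractionalIdeal.spanSingleton (𝓞 E)⁰ x)
  rw [Filter.eventually_cofinite] at h
  refine h.subset fun w hw => ?_
  rw [Set.mem_setOf_eq] at hw ⊢
  rw [show x = ((Units.mk0 x hx : Eˣ) : E) from rfl,
    FractionalIdeal.count_spanSingleton_eq_neg_log_valuation, neg_eq_zero]
  intro h0
  exact hw (by
    have := congrArg WithZero.exp h0
    rwa [WithZero.exp_log ((Valuation.ne_zero_iff _).2 hx), WithZero.exp_zero] at this)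

/-- **An `S`-supported principal generator**: for a finite set `U` of finite places of `K` there is
`a ∈ 𝓞_K`, `a ≠ 0`, lying in every `𝔭_u` (`u ∈ U`) and in no other prime — a generator of the
principal ideal `(∏_{u∈U} 𝔭_u)^h`, `h` the class number (finiteness of the class group).
[cite: NeukirchANT1999, Ch. I (6.3) (finiteness of the class number), (3.9)] -/
theorem exists_generator_supported (U : Finset (HeightOneSpectrum (𝓞 K))) :
    ∃ a : 𝓞 K, a ≠ 0 ∧ (∀ u ∈ U, u.intValuation a < 1) ∧
      ∀ v : HeightOneSpectrum (𝓞 K), v ∉ U → v.intValuation a = 1 := by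
  classical
  let I : Ideal (𝓞 K) := ∏ u ∈ U, u.asIdeal
  have hI0 : I ≠ 0 := by
    refine Finset.prod_ne_zero_iff.2 fun u _ => ?_
    exact u.ne_bot
  let h : ℕ := Fintype.card (ClassGroup (𝓞 K))
  have hIh0 : I ^ h ≠ ⊥ := pow_ne_zero _ hI0
  -- `(I^h)` is principal
  have hprinc : (I ^ h).IsPrincipal := by
    have hmem : I ^ h ∈ (Ideal (𝓞 K))⁰ := mem_nonZeroDivisors_of_ne_zero hIh0
    have hmemI : I ∈ (Ideal (𝓞 K))⁰ := mem_nonZeroDivisors_of_ne_zero hI0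
    have hcl : ClassGroup.mk0 ⟨I ^ h, hmem⟩ = 1 := by
      have : (⟨I ^ h, hmem⟩ : (Ideal (𝓞 K))⁰) = ⟨I, hmemI⟩ ^ h := Subtype.ext (by simp)
      rw [this, map_pow]
      exact pow_card_eq_one
    exact (ClassGroup.mk0_eq_one_iff hmem).1 hcl
  obtain ⟨a, ha⟩ := hprinc
  have haI : I ^ h = Ideal.span {a} := ha
  have ha0 : a ≠ 0 := by
    intro h0
    rw [h0, Ideal.span_singleton_eq_bot.2 rfl] at haI
    exact hIh0 haI
  have hh : h ≠ 0 := Fintype.card_ne_zero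
  refine ⟨a, ha0, fun u hu => ?_, fun v hv => ?_⟩
  · rw [HeightOneSpectrum.intValuation_lt_one_iff_dvd, ← haI]
    exact dvd_pow (Finset.dvd_prod_of_mem _ hu) hh
  · refine le_antisymm (v.intValuation_le_one a) (not_lt.1 fun hlt => hv ?_)
    rw [HeightOneSpectrum.intValuation_lt_one_iff_dvd, ← haI] at hlt
    have hvI : v.asIdeal ∣ I := v.prime.dvd_of_dvd_pow hlt
    obtain ⟨u, hu, hvu⟩ := (Prime.dvd_finsetProd_iff v.prime _).1 hvI
    have huv : u.asIdeal = v.asIdeal :=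
      u.isMaximal.eq_of_le v.isPrime.ne_top (Ideal.dvd_iff_le.1 hvu)
    have : v = u := HeightOneSpectrum.ext huv.symm
    rwa [this]

/-- **`⟸`, integrality**: if `w(x) ≤ 1` at every finite place `w` of `E` not above `S`, then `x` is
integral over `𝒪_{K,S}` (the proof in the module docstring: clear the finitely many poles above `S`
by an `S`-supported `a ∈ 𝓞_K`). [cite: NeukirchANT1999, Ch. I (11.6), Ch. VI §1]
[cite: NeukirchSchmidtWingberg2008, VIII §3] -/
theorem isIntegral_sInteger_of_forall_valuation_le_one {x : E}
    (hx : ∀ w : HeightOneSpectrum (𝓞 E), w.under (𝓞 K) ∉ S → w.valuation E x ≤ 1) :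
    IsIntegral (S.integer K) x := by
  classical
  by_cases hx0 : x = 0
  · rw [hx0]; exact isIntegral_zero
  -- the finitely many places where `x` has a pole, and the places of `K` below them (all in `S`)
  have hTfin : {w : HeightOneSpectrum (𝓞 E) | 1 < w.valuation E x}.Finite :=
    (finite_setOf_valuation_ne_one hx0).subset fun w hw => ne_of_gt hw
  let T : Finset (HeightOneSpectrum (𝓞 E)) := hTfin.toFinset
  let U : Finset (HeightOneSpectrum (𝓞 K)) := T.image fun w => w.under (𝓞 K)
  have hUS : ∀ u ∈ U, u ∈ S := by
    intro u hu
    obtain ⟨w, hw, rfl⟩ := Finset.mem_image.1 hu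
    by_contra hwS
    exact (lt_irrefl _) ((hTfin.mem_toFinset.1 hw).trans_le (hx w hwS))
  obtain ⟨a, ha0, haU, haU'⟩ := exists_generator_supported U
  -- `a` is an `S`-unit of `K`: `a⁻¹ ∈ 𝒪_{K,S}`
  have haK0 : (algebraMap (𝓞 K) K a) ≠ 0 := by
    rwa [Ne, map_eq_zero_iff _ (FaithfulSMul.algebraMap_injective (𝓞 K) K)]
  have hainv : (algebraMap (𝓞 K) K a)⁻¹ ∈ S.integer K := by
    intro v hv
    rw [map_inv₀, HeightOneSpectrum.valuation_of_algebraMap, haU' v (fun h => hv (hUS v h)), inv_one]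
  -- exponent `N` clearing all poles: `w(a)^N · w(x) ≤ 1` for `w ∈ T`
  obtain ⟨N, hN⟩ : ∃ N : ℕ, ∀ w ∈ T, w.valuation E x ≤ WithZero.exp (N : ℤ) := by
    refine ⟨T.sup fun w => (WithZero.log (w.valuation E x)).toNat, fun w hw => ?_⟩
    have hne : w.valuation E x ≠ 0 := (Valuation.ne_zero_iff _).2 hx0
    rw [← WithZero.exp_log hne, WithZero.exp_le_exp]
    exact (Int.self_le_toNat _).trans (Int.ofNat_le.2 (Finset.le_sup (f := fun w =>
      (WithZero.log (w.valuation E x)).toNat) hw))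
  let y : E := algebraMap K E (algebraMap (𝓞 K) K a) ^ N * x
  have hy : ∀ w : HeightOneSpectrum (𝓞 E), w.valuation E y ≤ 1 := by
    intro w
    haveI : w.asIdeal.LiesOver (w.under (𝓞 K)).asIdeal := ⟨rfl⟩
    have haw : w.valuation E (algebraMap K E (algebraMap (𝓞 K) K a)) ≤ 1 :=
      (valuation_algebraMap_le_one_iff w _).2 (HeightOneSpectrum.valuation_le_one _ a)
    rw [map_mul, map_pow]
    by_cases hwT : w ∈ T
    · -- a pole of `x`: `a ∈ 𝔭_{w.under}`, so `w(a) ≤ exp(-1)` and `w(a)^N ≤ exp(-N)`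
      have hu : w.under (𝓞 K) ∈ U := Finset.mem_image_of_mem _ hwT
      have haw1 : w.valuation E (algebraMap K E (algebraMap (𝓞 K) K a)) < 1 := by
        rw [← HeightOneSpectrum.valuation_liesOver E (w.under (𝓞 K)) w,
          HeightOneSpectrum.valuation_of_algebraMap]
        exact pow_lt_one₀ zero_le (haU _ hu)
          (Ideal.IsDedekindDomain.ramificationIdx'_ne_zero_of_liesOver w.asIdeal (w.under (𝓞 K)).ne_bot)
      -- `w(a) ≤ exp(-1)`
      have hle : w.valuation E (algebraMap K E (algebraMap (𝓞 K) K a)) ≤ WithZero.exp (-1 : ℤ) := by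
        have hne : w.valuation E (algebraMap K E (algebraMap (𝓞 K) K a)) ≠ 0 :=
          (Valuation.ne_zero_iff _).2 ((map_ne_zero _).2 haK0)
        rw [← WithZero.exp_log hne, WithZero.exp_le_exp]
        rw [← WithZero.exp_log hne, ← WithZero.exp_zero, WithZero.exp_lt_exp] at haw1
        omega
      calc w.valuation E (algebraMap K E (algebraMap (𝓞 K) K a)) ^ N * w.valuation E x
          ≤ WithZero.exp (-1 : ℤ) ^ N * WithZero.exp (N : ℤ) :=
            mul_le_mul' (pow_le_pow_left₀ zero_le hle N) (hN w hwT)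
        _ = 1 := by
            rw [← WithZero.exp_nsmul, ← WithZero.exp_add, ← WithZero.exp_zero]
            congr 1
            simp
    · -- no pole: both factors `≤ 1`
      have hxw : w.valuation E x ≤ 1 := not_lt.1 fun h => hwT (hTfin.mem_toFinset.2 h)
      exact mul_le_one' (pow_le_one₀ zero_le haw) hxw
  -- `y ∈ 𝓞_E`, hence integral over `ℤ ⊆ 𝒪_{K,S}`
  obtain ⟨y₀, hy₀⟩ := HeightOneSpectrum.mem_integers_of_valuation_le_one E y hy
  have hyint : IsIntegral (S.integer K) y := by
    rw [← hy₀]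
    exact (RingOfIntegers.isIntegral_coe y₀).tower_top
  -- `x = (a⁻¹)^N · y`
  have hxy : x = algebraMap K E ((algebraMap (𝓞 K) K a)⁻¹) ^ N * y := by
    rw [map_inv₀, inv_pow, ← mul_assoc, inv_mul_cancel₀ (pow_ne_zero _ ((map_ne_zero _).2 haK0)),
      one_mul]
  rw [hxy]
  refine IsIntegral.mul (IsIntegral.pow ?_ N) hyint
  have : algebraMap K E ((algebraMap (𝓞 K) K a)⁻¹) =
      algebraMap (S.integer K) E ⟨(algebraMap (𝓞 K) K a)⁻¹, hainv⟩ :=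
    (IsScalarTower.algebraMap_apply (S.integer K) K E _).symm ▸ rfl
  rw [this]
  exact isIntegral_algebraMap

/-- **The valuation characterisation of `S`-units**: for a finite extension `E/K` of number fields,
`x ∈ Eˣ` is an `S`-unit over `K` (it and its inverse integral over `𝒪_{K,S}`) iff `w(x) = 1` at
every finite place `w` of `E` not above `S` — i.e. `sUnits K S E` is the group `𝒪_{E,S_E}^×` of the
textbooks (`S_E` = the places of `E` above `S`). [cite: NeukirchSchmidtWingberg2008, VIII §3 (`E_{K,S} = 𝒪_{K,S}^×`)]
[cite: NeukirchANT1999, Ch. I (11.6), Ch. VI §1] -/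
theorem mem_sUnits_iff_forall_valuation_eq_one (x : Eˣ) :
    x ∈ sUnits K S E ↔
      ∀ w : HeightOneSpectrum (𝓞 E), w.under (𝓞 K) ∉ S → w.valuation E (x : E) = 1 := by
  refine ⟨fun hx w hw => valuation_eq_one_of_mem_sUnits hx w hw, fun h => ⟨?_, ?_⟩⟩
  · exact isIntegral_sInteger_of_forall_valuation_le_one fun w hw => (h w hw).le
  · refine isIntegral_sInteger_of_forall_valuation_le_one fun w hw => ?_
    rw [Units.val_inv_eq_inv_val, map_inv₀, h w hw, inv_one]

/-- The same in Mathlib's `Set.unit` currency: `sUnits K S E = S_E.unit E` with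
`S_E = {w | w.under (𝓞 K) ∈ S}` the places of `E` above `S`.
[cite: NeukirchSchmidtWingberg2008, VIII §3] -/
theorem sUnits_eq_unit_setOf_under_mem :
    sUnits K S E = ({w : HeightOneSpectrum (𝓞 E) | w.under (𝓞 K) ∈ S} : Set _).unit E := by
  ext x
  rw [mem_sUnits_iff_forall_valuation_eq_one]
  exact Iff.rfl

end Literature.NumberTheory.GaloisRepresentations.SUnits

end
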